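import Summits.HodgeConjecture.HodgeConjecture.Theorems.F0P3cStCharTSHFields          -- ★ (this seat) p851472 «H-FIELDS»: `exists_charSt`, `packetCharHRegularity_of_pins`, `isRegularElt_fst_of_isLocalGRegular` (+ its ★ cone: CharField, BoxCharFn, …)
import Summits.HodgeConjecture.HodgeConjecture.Theorems.F0P3cStCharTSHcbH             -- ★ (F0P3-p02 g20) p851449 «HCB-H★»: `exists_bound_DH_mul_of_boxChar` (HC-B at `N = 2` ⊗ bounded `χ₁`)
import HarnessLib

/-!
# F0 · P3c · line LH6 «StCharTS» — «H-FIELDS» SEQUEL: the Steinberg H-character WITH ITS BOX SHAPE EXPORTED and the (HCB-H) clause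
# `‖D_H · χ_{St_H}‖ ≤ B` on compacta [Rogawski1990, §1.6 p. 5; §4.9 pp. 54–55; §12.5 pp. 183–184] [HarishChandra1999AdmissibleDistributions, Thm. 16.3]

Cell `pub/hodgecm-mathlib`, crux H413 = `stmt-HodgeConjecture-24833` (lane `--supports …`), route HCCMUnconditional; seat F0P2-p01 (g21); datum road of LH6-p01 (g4),
ask of F0P3-p02 (g20) 12:30:59Z («export the (HCB-H) clause»).  THEOREMS ONLY (no definition ∕ instance ∕ notation ∕ named fact ∕ `sorry`); ★-only imports.

WHY A SEQUEL.  ★ `F0P3cStCharTSHFields.exists_charSt` delivers the (P4) clauses of `χ_{St_H} = 𝔇.charH πSt` as an OPAQUE `∃ Θ`; the H-side Harish-Chandra BOUND that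
S12a (`hHBH`, (DEF-H)), S13a∕S13c (`hHBH`, (U2)∕(HCB-up)∕(UP-DOM)) take as a hypothesis needs the PRODUCT SHAPE `Θ(γ₂, γ₁) = Θ₂(γ₂) · χ₁(γ₁)` with `Θ₂` a Harish-Chandra
character on `U(Φ₂)(L⁺_v)` — visible only inside that proof.  This file re-runs the construction with its internals exported and adds the bound:
* §1 `exists_charSt_boxShape` — `∃ πSt₂ μ₂ Θ₂` (Haar `μ₂` on `U(Φ₂)(L⁺_v)` with `μ₂ ⊗ haar = νHv`; `Θ₂` measurable, `L¹_loc(μ₂)`, locally constant at `U(2)`-regular points,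
  representing `Tr πSt₂`) such that `Θ := Θ₂ ⊗ χ₁` has the four (P4) clauses for `πSt` against `νHv` (same road as ★ `exists_charSt`: ★ S1 «CHAR-FIELD★» at `N = 2`,
  ★ `HLengthTwoLabels.exists_eq_boxChar`, ★ «BOXCHAR-FN★»).
* §2 `exists_charSt_hcb` — under the NAMED FACT (HC-B) ★ `normalizedCharacter_locallyBounded` in addition: `∃ Θ` with the four (P4) clauses AND the (HCB-H) clause
  «for every `DG₂` with ★ DG-FIELD's two letters at `N = 2` and every compact `C ⊆ H_v`, `‖DG₂(s.1) · Θ(s)‖` is bounded on `C`» — ONE call to F0P3-p02's ★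
  `F0P3cStCharTSHcbH.exists_bound_DH_mul_of_boxChar` (token shape as asked 12:30:59Z, `DH := DG₂ ∘ Prod.fst`).
* §3 `exists_charSt_packetCharHRegularity_hcb` — the rung-0 assembler's shape: ONE `Θ_St` carrying (P4) ∧ (HCB-H), and for every datum pinned to it
  ((P2) hRegH, (P3) hEH, hSq, `𝔇.charH πSt = Θ_St`) the socket (M1H) modulo the named stability sentence (★ `packetCharHRegularity_of_pins`).
HONEST LABEL: HC_CM is proved only modulo the 7 printed citations (2 remaining named inputs: hLiu418 = `stmt-HodgeConjecture-24832`, h413 = `stmt-HodgeConjecture-24833`)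
until rung 0 closes; count-neutral: the H-side bound hypotheses of (U2)(HCB-up)(DEF-H)(UP-DOM) reduce to (HC-B) ★ + the `charH`∕`DH` pins.

## References
* [Rogawski1990] J. D. Rogawski, *Automorphic Representations of Unitary Groups in Three Variables*, Ann. of Math. Stud. 123 (1990): §1.6 p. 5 (characters as
  functions, Harish-Chandra); §4.9 pp. 54–55 (`D_H`); §12.1 pp. 171–172 (`St_H(ξ)`); §12.5 pp. 183–184 (`H^r`, `H^e`); §12.7 Lemma 12.7.2 (proof) p. 193.
* [HarishChandra1999AdmissibleDistributions] Harish-Chandra (DeBacker–Sally, eds.), *Admissible Invariant Distributions on Reductive p-adic Groups*, ULS 16 (1999), Thm. 16.3.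
-/

set_option autoImplicit false
-- the mandated namespace has the single-problem summit's repeated segment (`HodgeConjecture.HodgeConjecture`)
set_option linter.dupNamespace false

noncomputable section

open NumberField IsDedekindDomain MeasureTheory Filter Topology Set
open scoped Matrix MatrixGroups NNReal ENNReal
open Literature.NumberTheory.Rogawski1990 Literature.NumberTheory.Automorphic Literature.NumberTheory.Automorphic.UnitaryGroup
open Literature.NumberTheory.Rogawski1990.Ch12Sec5

namespace Summit.HodgeConjecture.HodgeConjecture.Cruxes.H413.F0P3cStCharTSHFieldsHcb

variable (L : Type) [Field L] [NumberField L] [IsCMField L] (v : HeightOneSpectrum (𝓞 ↥(maximalRealSubfield L)))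

/-! ## §1 The Steinberg H-character with its box shape exported -/

set_option maxHeartbeats 1600000 in
-- carrier-level instance transport and ~10 ★ calls at the `cmDatum` spellings (as ★ `exists_charSt`)
/-- **«CHAR-FIELD-H★» WITH INTERNALS.**  At a NON-SPLIT `v`, under ★ `Ch1.characterLocallyIntegrable`, for a Borel σ-algebra on `U(Φ₂)(L⁺_v)`, the organ's Borel σ-algebra and
Haar measure `νHv` on `H_v`, and labels `(π₁, πSt)` of `i_H(χ₂ ⊠ χ₁)` (★ `HLengthTwoLabels`, `χ₁` continuous): there are a class `πSt₂` of `U(Φ₂)(L⁺_v)` with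
`πSt = πSt₂ ⊠ χ₁`, a Haar measure `μ₂` on `U(Φ₂)(L⁺_v)` and a Harish-Chandra character `Θ₂` of `πSt₂` against `μ₂` (measurable, `L¹_loc`, locally constant at
`U(2)`-regular points, representing `Tr πSt₂` on `C_c^∞`) such that `Θ := Θ₂ ⊗ χ₁` has the four (P4) clauses for `πSt` against `νHv`.
[cite: Rogawski1990, §1.6 p. 5; §12.1 pp. 171–172; §12.5 p. 183] [cite: HarishChandra1999AdmissibleDistributions, Thm. 16.3] -/
theorem exists_charSt_boxShape
    (hHC : Ch1.characterLocallyIntegrable)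
    (w : PlacesOver L v) (hw : IsCMField.complexConj L • w.1 = w.1)
    [iG₂ : MeasurableSpace ((UnitaryGroup.cmDatum L 2 (Matrix.of fun i j : Fin 2 => if i.val + j.val + 1 = 2 then (1 : L) else 0)).Local v)] [BorelSpace ((UnitaryGroup.cmDatum L 2 (Matrix.of fun i j : Fin 2 => if i.val + j.val + 1 = 2 then (1 : L) else 0)).Local v)]
    [inst : MeasurableSpace ((UnitaryGroup.cmDatum L 2 (Matrix.of fun i j : Fin 2 => if i.val + j.val + 1 = 2 then (1 : L) else 0)).Local v ×
        (UnitaryGroup.cmDatum L 1 (Matrix.of fun i j : Fin 1 => if i.val + j.val + 1 = 1 then (1 : L) else 0)).Local v)] [BorelSpace ((UnitaryGroup.cmDatum L 2 (Matrix.of fun i j : Fin 2 => if i.val + j.val + 1 = 2 then (1 : L) else 0)).Local v ×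
        (UnitaryGroup.cmDatum L 1 (Matrix.of fun i j : Fin 1 => if i.val + j.val + 1 = 1 then (1 : L) else 0)).Local v)]
    (νHv : Measure ((UnitaryGroup.cmDatum L 2 (Matrix.of fun i j : Fin 2 => if i.val + j.val + 1 = 2 then (1 : L) else 0)).Local v ×
        (UnitaryGroup.cmDatum L 1 (Matrix.of fun i j : Fin 1 => if i.val + j.val + 1 = 1 then (1 : L) else 0)).Local v)) [νHv.IsHaarMeasure]
    (χ₂ : ↥(torusU (conjLocal L (IsCMField.complexConj L) v) (cmLocalForm L 2 v)) →* ℂˣ)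
    (χ₁ : (UnitaryGroup.cmDatum L 1 (Matrix.of fun i j : Fin 1 => if i.val + j.val + 1 = 1 then (1 : L) else 0)).Local v →* ℂˣ) (hχ₁c : Continuous fun x => ((χ₁ x : ℂˣ) : ℂ))
    (π₁ πSt : IrrClass ((UnitaryGroup.cmDatum L 2 (Matrix.of fun i j : Fin 2 => if i.val + j.val + 1 = 2 then (1 : L) else 0)).Local v ×
        (UnitaryGroup.cmDatum L 1 (Matrix.of fun i j : Fin 1 => if i.val + j.val + 1 = 1 then (1 : L) else 0)).Local v))
    (hlab : HLengthTwoLabels L v χ₂ χ₁ π₁ πSt) :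
    ∃ (πSt₂ : IrrClass ((UnitaryGroup.cmDatum L 2 (Matrix.of fun i j : Fin 2 => if i.val + j.val + 1 = 2 then (1 : L) else 0)).Local v)) (μ₂ : Measure ((UnitaryGroup.cmDatum L 2 (Matrix.of fun i j : Fin 2 => if i.val + j.val + 1 = 2 then (1 : L) else 0)).Local v)) (Θ₂ : (UnitaryGroup.cmDatum L 2 (Matrix.of fun i j : Fin 2 => if i.val + j.val + 1 = 2 then (1 : L) else 0)).Local v → ℂ),
      μ₂.IsHaarMeasure ∧
      (Measurable Θ₂ ∧ LocallyIntegrable Θ₂ μ₂ ∧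
        (∀ x : (UnitaryGroup.cmDatum L 2 (Matrix.of fun i j : Fin 2 => if i.val + j.val + 1 = 2 then (1 : L) else 0)).Local v, IsRegularElt (x.val : GL (Fin 2) (UnitaryGroup.LocalRing L v)) → ∀ᶠ y in 𝓝 x, Θ₂ y = Θ₂ x) ∧
        ∀ φ : (UnitaryGroup.cmDatum L 2 (Matrix.of fun i j : Fin 2 => if i.val + j.val + 1 = 2 then (1 : L) else 0)).Local v → ℂ, IsLocSmooth φ → πSt₂.smoothTrace μ₂ φ = ∫ x, φ x * Θ₂ x ∂μ₂) ∧
      let Θ : (UnitaryGroup.cmDatum L 2 (Matrix.of fun i j : Fin 2 => if i.val + j.val + 1 = 2 then (1 : L) else 0)).Local v ×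
        (UnitaryGroup.cmDatum L 1 (Matrix.of fun i j : Fin 1 => if i.val + j.val + 1 = 1 then (1 : L) else 0)).Local v → ℂ := fun h => Θ₂ h.1 * ((χ₁ h.2 : ℂˣ) : ℂ)
      Measurable Θ ∧ LocallyIntegrable Θ νHv ∧
        (∀ x : (UnitaryGroup.cmDatum L 2 (Matrix.of fun i j : Fin 2 => if i.val + j.val + 1 = 2 then (1 : L) else 0)).Local v ×
        (UnitaryGroup.cmDatum L 1 (Matrix.of fun i j : Fin 1 => if i.val + j.val + 1 = 1 then (1 : L) else 0)).Local v, IsLocalGRegular L v x → ∀ᶠ y in 𝓝 x, Θ y = Θ x) ∧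
        (∀ fH : (UnitaryGroup.cmDatum L 2 (Matrix.of fun i j : Fin 2 => if i.val + j.val + 1 = 2 then (1 : L) else 0)).Local v ×
        (UnitaryGroup.cmDatum L 1 (Matrix.of fun i j : Fin 1 => if i.val + j.val + 1 = 1 then (1 : L) else 0)).Local v → ℂ, IsLocSmooth fH → πSt.smoothTrace νHv fH = ∫ h, fH h * Θ h ∂νHv) := by
  classical
  letI iG₁ : MeasurableSpace ((UnitaryGroup.cmDatum L 1 (Matrix.of fun i j : Fin 1 => if i.val + j.val + 1 = 1 then (1 : L) else 0)).Local v) := borel _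
  haveI : BorelSpace ((UnitaryGroup.cmDatum L 1 (Matrix.of fun i j : Fin 1 => if i.val + j.val + 1 = 1 then (1 : L) else 0)).Local v) := ⟨rfl⟩
  haveI : NonarchimedeanGroup ((UnitaryGroup.cmDatum L 2 (Matrix.of fun i j : Fin 2 => if i.val + j.val + 1 = 2 then (1 : L) else 0)).Local v) :=
    nonarchimedeanGroup_unitaryGroupOfForm_local (E := L) (c := IsCMField.complexConj L) (N := 2) (v := v)
      (J' := (adelicForm L 2 (Matrix.of fun i j : Fin 2 => if i.val + j.val + 1 = 2 then (1 : L) else 0)).map (adeleToLocal L v))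
  haveI : NonarchimedeanGroup ((UnitaryGroup.cmDatum L 1 (Matrix.of fun i j : Fin 1 => if i.val + j.val + 1 = 1 then (1 : L) else 0)).Local v) :=
    nonarchimedeanGroup_unitaryGroupOfForm_local (E := L) (c := IsCMField.complexConj L) (N := 1) (v := v)
      (J' := (adelicForm L 1 (Matrix.of fun i j : Fin 1 => if i.val + j.val + 1 = 1 then (1 : L) else 0)).map (adeleToLocal L v))
  haveI : CompactSpace ((UnitaryGroup.cmDatum L 1 (Matrix.of fun i j : Fin 1 => if i.val + j.val + 1 = 1 then (1 : L) else 0)).Local v) := compactSpace_cmDatum_local_one_of_smul_eq L v w hw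
  -- the organ's σ-algebra on the product IS the product of the factor Borel σ-algebras
  have hinst : inst = Prod.instMeasurableSpace :=
    (‹BorelSpace ((UnitaryGroup.cmDatum L 2 (Matrix.of fun i j : Fin 2 => if i.val + j.val + 1 = 2 then (1 : L) else 0)).Local v ×
        (UnitaryGroup.cmDatum L 1 (Matrix.of fun i j : Fin 1 => if i.val + j.val + 1 = 1 then (1 : L) else 0)).Local v)›.measurable_eq).trans
      (@BorelSpace.measurable_eq ((UnitaryGroup.cmDatum L 2 (Matrix.of fun i j : Fin 2 => if i.val + j.val + 1 = 2 then (1 : L) else 0)).Local v ×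
        (UnitaryGroup.cmDatum L 1 (Matrix.of fun i j : Fin 1 => if i.val + j.val + 1 = 1 then (1 : L) else 0)).Local v) _ Prod.instMeasurableSpace Prod.borelSpace).symm
  subst hinst
  have hχ₁ : IsOpen ((χ₁.ker : Subgroup ((UnitaryGroup.cmDatum L 1 (Matrix.of fun i j : Fin 1 => if i.val + j.val + 1 = 1 then (1 : L) else 0)).Local v)) : Set ((UnitaryGroup.cmDatum L 1 (Matrix.of fun i j : Fin 1 => if i.val + j.val + 1 = 1 then (1 : L) else 0)).Local v)) :=
    F0P3bHPrincipalSeriesJHOfUTwo.isOpen_ker_of_continuous_unitsComplex χ₁ hχ₁c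
  obtain ⟨π₁₂, πSt₂, -, hSt, -, hJH⟩ := HLengthTwoLabels.exists_eq_boxChar (hχ₁ := hχ₁) hlab
  have hadm : πSt₂.IsAdmissible := by
    haveI := locallyCompactSpace_cmBorelU L 2 v
    exact F0P3XiPacketFamilyOfRecord.isAdmissible_of_isConstituentOf ((hJH πSt₂).2 (Or.inr rfl))
      (isAdmissible_cmPrincipalSeries_of_iwasawa L 2 v (exists_borel_mul_mem_cmLocalIntegralLevel L 2 v) χ₂)
  set μ₁ : Measure ((UnitaryGroup.cmDatum L 1 (Matrix.of fun i j : Fin 1 => if i.val + j.val + 1 = 1 then (1 : L) else 0)).Local v) := Measure.haar with hμ₁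
  set μ₀ : Measure ((UnitaryGroup.cmDatum L 2 (Matrix.of fun i j : Fin 2 => if i.val + j.val + 1 = 2 then (1 : L) else 0)).Local v) := Measure.haar with hμ₀
  have hc := Measure.haarScalarFactor_pos_of_isHaarMeasure νHv (μ₀.prod μ₁)
  set μ₂ : Measure ((UnitaryGroup.cmDatum L 2 (Matrix.of fun i j : Fin 2 => if i.val + j.val + 1 = 2 then (1 : L) else 0)).Local v) := ((νHv.haarScalarFactor (μ₀.prod μ₁) : ℝ≥0∞)) • μ₀ with hμ₂
  haveI hμ₂H : μ₂.IsHaarMeasure := Measure.IsHaarMeasure.smul μ₀ (ENNReal.coe_ne_zero.2 hc.ne') ENNReal.coe_ne_top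
  have hprod : μ₂.prod μ₁ = νHv := by
    rw [hμ₂, Measure.prod_smul_left, Measure.coe_nnreal_smul]
    exact (Measure.isMulLeftInvariant_eq_smul νHv (μ₀.prod μ₁)).symm
  obtain ⟨Θ₂, hm₂, hli₂, hlc₂, htr₂⟩ :=
    F0P3cStCharTSCharField.exists_charRegular_of_characterLocallyIntegrable_of_nonsplit L
      (Matrix.of fun i j : Fin 2 => if i.val + j.val + 1 = 2 then (1 : L) else 0) v hHC
      (antidiagOne_isHermitian L 2) (isUnit_antidiagOne_det L 2).ne_zero w hw μ₂ πSt₂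
  refine ⟨πSt₂, μ₂, Θ₂, hμ₂H, ⟨hm₂, hli₂, hlc₂, htr₂⟩, F0P3cStCharTSBoxCharFn.measurable_boxCharFn hm₂ hχ₁c, ?_, ?_, ?_⟩
  · rw [← hprod]
    exact F0P3cStCharTSBoxCharFn.locallyIntegrable_boxCharFn μ₂ μ₁ hli₂ hχ₁c
  · intro x hx
    exact F0P3cStCharTSBoxCharFn.eventually_boxCharFn_eq hχ₁
      (hlc₂ x.1 (F0P3cStCharTSHFields.isRegularElt_fst_of_isLocalGRegular L v x hx)) x.2
  · intro fH hfH
    rw [hSt, ← hprod]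
    exact F0P3cStCharTSBoxCharFn.smoothTrace_boxChar_eq_integral μ₂ μ₁ πSt₂ hadm χ₁ hχ₁ hχ₁c Θ₂ hli₂ htr₂ fH hfH

/-! ## §2 The (HCB-H) clause exported (F0P3-p02 (g20)'s ask, one call to ★ `exists_bound_DH_mul_of_boxChar`) -/

set_option maxHeartbeats 1600000 in
-- as §1
/-- **«CHAR-FIELD-H★» + (HCB-H).**  Under ★ `Ch1.characterLocallyIntegrable` AND the named fact (HC-B) ★ `normalizedCharacter_locallyBounded` [Harish-Chandra Thm. 16.3]:
the Steinberg label has a character function `Θ` on `H_v` with the four (P4) clauses and, for every `DG₂` carrying ★ DG-FIELD's two letters at `N = 2` (zero at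
non-unit discriminant; `√√‖u‖` when `u·det = discr`) — in particular the ★ `exists_DG_field_two` witness, `D_H = DG₂ ∘ Prod.fst` [§4.9 pp. 54–55] — a bound
`‖DG₂(s.1)·Θ(s)‖ ≤ B` on every compact `C ⊆ H_v` (Harish-Chandra on the `U(Φ₂)` projection, `χ₁` bounded on the `U(Φ₁)` projection).
[cite: Rogawski1990, §1.6 p. 5; §4.9 pp. 54–55; §12.5 pp. 183–184; §12.7 Lemma 12.7.2 (proof) p. 193] [cite: HarishChandra1999AdmissibleDistributions, Thm. 16.3] -/
theorem exists_charSt_hcb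
    (hHC : Ch1.characterLocallyIntegrable) (hHCB : normalizedCharacter_locallyBounded)
    (w : PlacesOver L v) (hw : IsCMField.complexConj L • w.1 = w.1)
    [MeasurableSpace ((UnitaryGroup.cmDatum L 2 (Matrix.of fun i j : Fin 2 => if i.val + j.val + 1 = 2 then (1 : L) else 0)).Local v)] [BorelSpace ((UnitaryGroup.cmDatum L 2 (Matrix.of fun i j : Fin 2 => if i.val + j.val + 1 = 2 then (1 : L) else 0)).Local v)]
    [MeasurableSpace ((UnitaryGroup.cmDatum L 2 (Matrix.of fun i j : Fin 2 => if i.val + j.val + 1 = 2 then (1 : L) else 0)).Local v ×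
        (UnitaryGroup.cmDatum L 1 (Matrix.of fun i j : Fin 1 => if i.val + j.val + 1 = 1 then (1 : L) else 0)).Local v)] [BorelSpace ((UnitaryGroup.cmDatum L 2 (Matrix.of fun i j : Fin 2 => if i.val + j.val + 1 = 2 then (1 : L) else 0)).Local v ×
        (UnitaryGroup.cmDatum L 1 (Matrix.of fun i j : Fin 1 => if i.val + j.val + 1 = 1 then (1 : L) else 0)).Local v)]
    (νHv : Measure ((UnitaryGroup.cmDatum L 2 (Matrix.of fun i j : Fin 2 => if i.val + j.val + 1 = 2 then (1 : L) else 0)).Local v ×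
        (UnitaryGroup.cmDatum L 1 (Matrix.of fun i j : Fin 1 => if i.val + j.val + 1 = 1 then (1 : L) else 0)).Local v)) [νHv.IsHaarMeasure]
    (χ₂ : ↥(torusU (conjLocal L (IsCMField.complexConj L) v) (cmLocalForm L 2 v)) →* ℂˣ)
    (χ₁ : (UnitaryGroup.cmDatum L 1 (Matrix.of fun i j : Fin 1 => if i.val + j.val + 1 = 1 then (1 : L) else 0)).Local v →* ℂˣ) (hχ₁c : Continuous fun x => ((χ₁ x : ℂˣ) : ℂ))
    (π₁ πSt : IrrClass ((UnitaryGroup.cmDatum L 2 (Matrix.of fun i j : Fin 2 => if i.val + j.val + 1 = 2 then (1 : L) else 0)).Local v ×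
        (UnitaryGroup.cmDatum L 1 (Matrix.of fun i j : Fin 1 => if i.val + j.val + 1 = 1 then (1 : L) else 0)).Local v))
    (hlab : HLengthTwoLabels L v χ₂ χ₁ π₁ πSt) :
    ∃ Θ : (UnitaryGroup.cmDatum L 2 (Matrix.of fun i j : Fin 2 => if i.val + j.val + 1 = 2 then (1 : L) else 0)).Local v ×
        (UnitaryGroup.cmDatum L 1 (Matrix.of fun i j : Fin 1 => if i.val + j.val + 1 = 1 then (1 : L) else 0)).Local v → ℂ,
      (Measurable Θ ∧ LocallyIntegrable Θ νHv ∧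
        (∀ x : (UnitaryGroup.cmDatum L 2 (Matrix.of fun i j : Fin 2 => if i.val + j.val + 1 = 2 then (1 : L) else 0)).Local v ×
        (UnitaryGroup.cmDatum L 1 (Matrix.of fun i j : Fin 1 => if i.val + j.val + 1 = 1 then (1 : L) else 0)).Local v, IsLocalGRegular L v x → ∀ᶠ y in 𝓝 x, Θ y = Θ x) ∧
        (∀ fH : (UnitaryGroup.cmDatum L 2 (Matrix.of fun i j : Fin 2 => if i.val + j.val + 1 = 2 then (1 : L) else 0)).Local v ×
        (UnitaryGroup.cmDatum L 1 (Matrix.of fun i j : Fin 1 => if i.val + j.val + 1 = 1 then (1 : L) else 0)).Local v → ℂ, IsLocSmooth fH → πSt.smoothTrace νHv fH = ∫ h, fH h * Θ h ∂νHv)) ∧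
      ∀ DG₂ : (UnitaryGroup.cmDatum L 2 (Matrix.of fun i j : Fin 2 => if i.val + j.val + 1 = 2 then (1 : L) else 0)).Local v → ℝ,
        (∀ γ : (UnitaryGroup.cmDatum L 2 (Matrix.of fun i j : Fin 2 => if i.val + j.val + 1 = 2 then (1 : L) else 0)).Local v, ¬ IsUnit ((γ.val.val.charpoly).discr) → DG₂ γ = 0) →
        (∀ (γ : (UnitaryGroup.cmDatum L 2 (Matrix.of fun i j : Fin 2 => if i.val + j.val + 1 = 2 then (1 : L) else 0)).Local v) (u : (UnitaryGroup.LocalRing L v)ˣ),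
          (u : UnitaryGroup.LocalRing L v) * (γ.val.val.det) ^ (2 - 1) = (γ.val.val.charpoly).discr →
            DG₂ γ = ((NNReal.sqrt (NNReal.sqrt (unitModulusChar (UnitaryGroup.LocalRing L v) u)) : ℝ≥0) : ℝ)) →
        ∀ C : Set ((UnitaryGroup.cmDatum L 2 (Matrix.of fun i j : Fin 2 => if i.val + j.val + 1 = 2 then (1 : L) else 0)).Local v ×
        (UnitaryGroup.cmDatum L 1 (Matrix.of fun i j : Fin 1 => if i.val + j.val + 1 = 1 then (1 : L) else 0)).Local v), IsCompact C → ∃ B : ℝ, ∀ s ∈ C, ‖(DG₂ s.1 : ℂ) * Θ s‖ ≤ B := by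
  obtain ⟨πSt₂, μ₂, Θ₂, hμ₂, ⟨hm₂, hli₂, hlc₂, htr₂⟩, h4⟩ :=
    exists_charSt_boxShape L v hHC w hw νHv χ₂ χ₁ hχ₁c π₁ πSt hlab
  haveI := hμ₂
  refine ⟨fun h => Θ₂ h.1 * ((χ₁ h.2 : ℂˣ) : ℂ), h4, fun DG₂ h0 hrel C hC => ?_⟩
  exact F0P3cStCharTSHcbH.exists_bound_DH_mul_of_boxChar L v hHCB
    (Matrix.of fun i j : Fin 2 => if i.val + j.val + 1 = 2 then (1 : L) else 0)
    (antidiagOne_isHermitian L 2) (isUnit_antidiagOne_det L 2).ne_zero μ₂ πSt₂ Θ₂ hli₂ hlc₂ htr₂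
    (fun x => ((χ₁ x : ℂˣ) : ℂ)) hχ₁c DG₂ h0 hrel (fun h => DG₂ h.1) (fun _ => rfl) _ (fun _ => rfl) C hC

/-! ## §3 The rung-0 assembler's shape with the fifth clause carried -/

set_option maxHeartbeats 1600000 in
-- as §1
/-- **«H-FIELDS» FOR THE RUNG-0 ASSEMBLER, with (HCB-H).**  ONE function `Θ_St` on `H_v` with the four (P4) clauses and the (HCB-H) clause, such that every §12.5
datum `𝔇` on `(U(Φ₃)(L⁺_v), H_v)` with COMPAT `𝔇.μH = νHv`, `𝔇.charH πSt = Θ_St`, the pins (P2) hRegH ∕ (P3) hEH and hSq satisfies the socket (M1H) once the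
named sentence «`Θ_St` is a stable class function on `H^r`» [§12.5 p. 183; §12.7 p. 191; §11.1] is supplied; and S12a∕S13a∕S13c's `hHBH` follow from the fifth
clause at `DH := DG₂ ∘ Prod.fst` (★ `F0P3cStCharTSHcbH.hHBH_of_compactBound` ∕ `hHBH_cartanH_of_compactBound`).
[cite: Rogawski1990, §1.6 p. 5; §4.9 pp. 54–55; §12.5 pp. 183–184; §12.7 p. 191] [cite: HarishChandra1999AdmissibleDistributions, Thm. 16.3] -/
theorem exists_charSt_packetCharHRegularity_hcb
    (hHC : Ch1.characterLocallyIntegrable) (hHCB : normalizedCharacter_locallyBounded)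
    (w : PlacesOver L v) (hw : IsCMField.complexConj L • w.1 = w.1)
    [MeasurableSpace (Gqs L v)]
    [∀ γ : Gqs L v, MeasurableSpace (Gqs L v ⧸ Subgroup.centralizer ({γ} : Set (Gqs L v)))]
    [MeasurableSpace (Gqs L v ⧸ Subgroup.center (Gqs L v))]
    [MeasurableSpace ((UnitaryGroup.cmDatum L 2 (Matrix.of fun i j : Fin 2 => if i.val + j.val + 1 = 2 then (1 : L) else 0)).Local v)] [BorelSpace ((UnitaryGroup.cmDatum L 2 (Matrix.of fun i j : Fin 2 => if i.val + j.val + 1 = 2 then (1 : L) else 0)).Local v)]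
    [MeasurableSpace ((UnitaryGroup.cmDatum L 2 (Matrix.of fun i j : Fin 2 => if i.val + j.val + 1 = 2 then (1 : L) else 0)).Local v ×
        (UnitaryGroup.cmDatum L 1 (Matrix.of fun i j : Fin 1 => if i.val + j.val + 1 = 1 then (1 : L) else 0)).Local v)] [BorelSpace ((UnitaryGroup.cmDatum L 2 (Matrix.of fun i j : Fin 2 => if i.val + j.val + 1 = 2 then (1 : L) else 0)).Local v ×
        (UnitaryGroup.cmDatum L 1 (Matrix.of fun i j : Fin 1 => if i.val + j.val + 1 = 1 then (1 : L) else 0)).Local v)]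
    (νHv : Measure ((UnitaryGroup.cmDatum L 2 (Matrix.of fun i j : Fin 2 => if i.val + j.val + 1 = 2 then (1 : L) else 0)).Local v ×
        (UnitaryGroup.cmDatum L 1 (Matrix.of fun i j : Fin 1 => if i.val + j.val + 1 = 1 then (1 : L) else 0)).Local v)) [νHv.IsHaarMeasure]
    (χ₂ : ↥(torusU (conjLocal L (IsCMField.complexConj L) v) (cmLocalForm L 2 v)) →* ℂˣ)
    (χ₁ : (UnitaryGroup.cmDatum L 1 (Matrix.of fun i j : Fin 1 => if i.val + j.val + 1 = 1 then (1 : L) else 0)).Local v →* ℂˣ) (hχ₁c : Continuous fun x => ((χ₁ x : ℂˣ) : ℂ))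
    (π₁ πSt : IrrClass ((UnitaryGroup.cmDatum L 2 (Matrix.of fun i j : Fin 2 => if i.val + j.val + 1 = 2 then (1 : L) else 0)).Local v ×
        (UnitaryGroup.cmDatum L 1 (Matrix.of fun i j : Fin 1 => if i.val + j.val + 1 = 1 then (1 : L) else 0)).Local v))
    (hlab : HLengthTwoLabels L v χ₂ χ₁ π₁ πSt) :
    ∃ Θ : (UnitaryGroup.cmDatum L 2 (Matrix.of fun i j : Fin 2 => if i.val + j.val + 1 = 2 then (1 : L) else 0)).Local v ×
        (UnitaryGroup.cmDatum L 1 (Matrix.of fun i j : Fin 1 => if i.val + j.val + 1 = 1 then (1 : L) else 0)).Local v → ℂ,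
      (Measurable Θ ∧ LocallyIntegrable Θ νHv ∧
        (∀ x : (UnitaryGroup.cmDatum L 2 (Matrix.of fun i j : Fin 2 => if i.val + j.val + 1 = 2 then (1 : L) else 0)).Local v ×
        (UnitaryGroup.cmDatum L 1 (Matrix.of fun i j : Fin 1 => if i.val + j.val + 1 = 1 then (1 : L) else 0)).Local v, IsLocalGRegular L v x → ∀ᶠ y in 𝓝 x, Θ y = Θ x) ∧
        (∀ fH : (UnitaryGroup.cmDatum L 2 (Matrix.of fun i j : Fin 2 => if i.val + j.val + 1 = 2 then (1 : L) else 0)).Local v ×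
        (UnitaryGroup.cmDatum L 1 (Matrix.of fun i j : Fin 1 => if i.val + j.val + 1 = 1 then (1 : L) else 0)).Local v → ℂ, IsLocSmooth fH → πSt.smoothTrace νHv fH = ∫ h, fH h * Θ h ∂νHv)) ∧
      (∀ DG₂ : (UnitaryGroup.cmDatum L 2 (Matrix.of fun i j : Fin 2 => if i.val + j.val + 1 = 2 then (1 : L) else 0)).Local v → ℝ,
        (∀ γ : (UnitaryGroup.cmDatum L 2 (Matrix.of fun i j : Fin 2 => if i.val + j.val + 1 = 2 then (1 : L) else 0)).Local v, ¬ IsUnit ((γ.val.val.charpoly).discr) → DG₂ γ = 0) →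
        (∀ (γ : (UnitaryGroup.cmDatum L 2 (Matrix.of fun i j : Fin 2 => if i.val + j.val + 1 = 2 then (1 : L) else 0)).Local v) (u : (UnitaryGroup.LocalRing L v)ˣ),
          (u : UnitaryGroup.LocalRing L v) * (γ.val.val.det) ^ (2 - 1) = (γ.val.val.charpoly).discr →
            DG₂ γ = ((NNReal.sqrt (NNReal.sqrt (unitModulusChar (UnitaryGroup.LocalRing L v) u)) : ℝ≥0) : ℝ)) →
        ∀ C : Set ((UnitaryGroup.cmDatum L 2 (Matrix.of fun i j : Fin 2 => if i.val + j.val + 1 = 2 then (1 : L) else 0)).Local v ×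
        (UnitaryGroup.cmDatum L 1 (Matrix.of fun i j : Fin 1 => if i.val + j.val + 1 = 1 then (1 : L) else 0)).Local v), IsCompact C → ∃ B : ℝ, ∀ s ∈ C, ‖(DG₂ s.1 : ℂ) * Θ s‖ ≤ B) ∧
      ∀ 𝔇 : EllipticData (Gqs L v) ((UnitaryGroup.cmDatum L 2 (Matrix.of fun i j : Fin 2 => if i.val + j.val + 1 = 2 then (1 : L) else 0)).Local v ×
        (UnitaryGroup.cmDatum L 1 (Matrix.of fun i j : Fin 1 => if i.val + j.val + 1 = 1 then (1 : L) else 0)).Local v),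
        𝔇.μH = νHv → 𝔇.charH πSt = Θ →
        (∀ a, a ∈ 𝔇.regH ↔ IsLocalGRegular L v a) →
        (∀ a, a ∈ 𝔇.ellH ↔ IsLocalGRegular L v a ∧
          IsCompact ((Subgroup.centralizer ({a} : Set ((UnitaryGroup.cmDatum L 2 (Matrix.of fun i j : Fin 2 => if i.val + j.val + 1 = 2 then (1 : L) else 0)).Local v ×
        (UnitaryGroup.cmDatum L 1 (Matrix.of fun i j : Fin 1 => if i.val + j.val + 1 = 1 then (1 : L) else 0)).Local v)) :
              Subgroup ((UnitaryGroup.cmDatum L 2 (Matrix.of fun i j : Fin 2 => if i.val + j.val + 1 = 2 then (1 : L) else 0)).Local v ×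
        (UnitaryGroup.cmDatum L 1 (Matrix.of fun i j : Fin 1 => if i.val + j.val + 1 = 1 then (1 : L) else 0)).Local v)) :
            Set ((UnitaryGroup.cmDatum L 2 (Matrix.of fun i j : Fin 2 => if i.val + j.val + 1 = 2 then (1 : L) else 0)).Local v ×
        (UnitaryGroup.cmDatum L 1 (Matrix.of fun i j : Fin 1 => if i.val + j.val + 1 = 1 then (1 : L) else 0)).Local v))) →
        𝔇.sqPacketsH = {({πSt} : Finset (IrrClass ((UnitaryGroup.cmDatum L 2 (Matrix.of fun i j : Fin 2 => if i.val + j.val + 1 = 2 then (1 : L) else 0)).Local v ×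
        (UnitaryGroup.cmDatum L 1 (Matrix.of fun i j : Fin 1 => if i.val + j.val + 1 = 1 then (1 : L) else 0)).Local v)))} →
        IsStableClassFunOn 𝔇.stConjH 𝔇.regH Θ →
        𝔇.PacketCharHRegularity := by
  obtain ⟨Θ, ⟨hm, hli, hlc, htr⟩, hB⟩ := exists_charSt_hcb L v hHC hHCB w hw νHv χ₂ χ₁ hχ₁c π₁ πSt hlab
  refine ⟨Θ, ⟨hm, hli, hlc, htr⟩, hB, fun 𝔇 hμH hch hRegH hEH hSq hstab => ?_⟩
  refine F0P3cStCharTSHFields.packetCharHRegularity_of_pins L v νHv 𝔇 πSt hμH hRegH hEH hSq ?_ ?_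
  · rw [hch]
    exact ⟨hm, hli, fun x hx => hlc x ((hRegH x).1 hx), htr⟩
  · rw [hch]
    exact hstab

end Summit.HodgeConjecture.HodgeConjecture.Cruxes.H413.F0P3cStCharTSHFieldsHcb

end
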